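import Literature.NumberTheory.EllipticCurves.LeadingTermBSZReductionTypesProofs
import Literature.NumberTheory.EllipticCurves.KramerCurvesPadic
import Literature.NumberTheory.EllipticCurves.QuadraticTwistLocalPolynomialProofs
import HarnessLib

/-!
# Bhargava–Skinner–Zhang, proof of Lemma 18: split and non-split multiplicative reduction of
# `E_{A,B}` at `p ≥ 5`, and the residue classes `Σ₅^spl`, `Σ₅^ns` modulo `5`

`Proofs` companion of `Literature/NumberTheory/EllipticCurves/LeadingTerm.lean` (bsd.S27,
`Literature.NumberTheory.EllipticCurves.bhargava_skinner_zhang`), continuing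
`LeadingTermBSZReductionTypesProofs.lean` (good / multiplicative / additive reduction of `E_{A,B}`
at `p ≥ 5`). Source: M. Bhargava, C. Skinner, W. Zhang, *A majority of elliptic curves over `ℚ`
satisfy the Birch and Swinnerton-Dyer conjecture*, arXiv:1407.1826 (2014), proof of Lemma 18
(pp. 8–9):

> "We claim that if `E_{A,B}` has multiplicative reduction at `p`, then it has split multiplicative
> reduction if and only if `u⁴ ≡ -3A (mod p)` has a solution. To see this, we work over `𝔽_p`. Let
> `x₀ ∈ 𝔽_p` be the double root of `x³+Ax+B`, so `3x₀² = -A`. The equations for the tangent lines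
> at the nodal point `(x₀,0)` … are `y - α(x-x₀) = 0` and `y - β(x-x₀) = 0` … `α + β = 0` …
> `-α²x₀ = A` … `α⁴ = -3A`. As `E_{A,B}` has split multiplicative reduction if and only if
> `α, β ∈ 𝔽_p`, the claim follows."
> "`Σ₅^ns` is the set of those `(A,B)` with `A ≡ 2 (mod 5)` and `B ≡ ±2 (mod 5)` … (non-split
> multiplicative reduction at `5` …); `Σ₅^spl` is the set of those `(A,B)` with `A ≡ 3 (mod 5)`
> and `B ≡ ±1 (mod 5)` … (split multiplicative reduction at `5` …)."

What is PROVED here, in the tree's `p`-adic spelling `WeierstrassCurve.HasSplitMultiplicativeReductionAtPrime`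
(`PAdicHeights.lean`: Mathlib's `HasSplitMultiplicativeReduction` — the node-tangent polynomial
`c₄T² + a₁c₄T - (54b₆ - 3b₂b₄ + a₂c₄)` of the integral minimal model splits over the residue field —
for the `ℤ_p`-minimal model of `E / ℚ_p`; the vocabulary of `TateParameterData` / `LInvariant`, in
which condition "(e) `ord_p(𝓛(E)) = 1` if split multiplicative" of Theorem 9 of the source lives):

* `hasSplitMultiplicativeReductionAtPrime_shortWeierstrass_iff` — for a prime `p ≥ 5`, `p ∤ A`,
  `p ∣ 4A³ + 27B² ≠ 0` (multiplicative reduction): `E_{A,B}` has SPLIT multiplicative reduction at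
  `p` iff `-2AB` is a square modulo `p`. Mechanism: the equation `E_{A,B}` is `p`-integral with unit
  `c₄ = -48A`, hence minimal (Silverman VII.1 Rem. 1.1), its node-tangent polynomial is
  `-48A·T² - 216B`, of discriminant `-c₄c₆ = -2⁹3⁴·AB` (the tree's `discrim_nodalTangents`), a
  square iff `-2AB` is; in the source's terms the slopes are `α² = 3x₀ = -9B/(2A)`, and
  `-9B/(2A) = (3/(2A))²·(-2AB)`, with `α⁴ = 9x₀² = -3A`. (The source's "iff `u⁴ ≡ -3A` is solvable"
  is this criterion when `-1` is a square mod `p`, in particular at `p = 5`; for `p ≡ 3 (mod 4)` the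
  solvability of `u⁴ ≡ -3A` is only necessary — e.g. `p = 7`, `(A,B) = (-3,2)`: `y² = (x-1)²(x+2)`
  has slopes `α² = 3`, a non-square mod `7`, although `u⁴ ≡ 9 ≡ 2` has the solution `u = 2` — so the
  general sentence is recorded here in its correct form `-2AB ≡ □`; the source only uses `p = 5`.)
* `bsz_sigma_classes_mod_five` — the residue computation modulo `5`: for `a ≢ 0`, `4a³ + 27b² ≡ 0`
  forces `(a,b) ∈ {(2,±2), (3,±1)}`, and `-2ab` is a square exactly for `(3,±1)` (`decide`);
* `hasSplitMultiplicativeReductionAtPrime_five_shortWeierstrass_iff` — for `(A,B)` with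
  `4A³ + 27B² ≠ 0` and `¬(5⁴ ∣ A ∧ 5⁶ ∣ B)`: `E_{A,B}` has split multiplicative reduction at `5`
  iff `A ≡ 3` and `B ≡ ±1 (mod 5)` — the source's `Σ₅^spl` classes;
* `hasMultiplicative_not_split_five_shortWeierstrass_iff` — non-split multiplicative reduction at
  `5` iff `A ≡ 2` and `B ≡ ±2 (mod 5)` — the source's `Σ₅^ns` classes.

No definitions and no named facts are introduced (D-0026).

## References

* M. Bhargava, C. Skinner, W. Zhang, arXiv:1407.1826 (2014), proof of Lemma 18 (pp. 8–9).
  [cite: BhargavaSkinnerZhang2014, Lemma 18 (proof)]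
* J. H. Silverman, *The Arithmetic of Elliptic Curves*, GTM 106, 2nd ed. (2009), VII.1 Remark 1.1
  (unit `c₄` ⇒ minimal), VII.5 Prop. 5.1(b) and the definition of split multiplicative reduction
  (rational tangent slopes at the node), Ex. 3.5. [cite: SilvermanAEC2009, VII.5 Prop. 5.1(b)]
-/

noncomputable section

open IsLocalRing IsDedekindDomain Polynomial WeierstrassCurve

namespace Literature.NumberTheory.EllipticCurves

namespace BSZLemma18Split

/-! ### Invariants of `[0, 0, 0, a, b]` over any ring -/

variable {R : Type*} [CommRing R]

/-- `c₄ = -48a`. [folklore] -/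
theorem c₄_short (a b : R) : (⟨0, 0, 0, a, b⟩ : WeierstrassCurve R).c₄ = -48 * a := by
  simp only [WeierstrassCurve.c₄, WeierstrassCurve.b₂, WeierstrassCurve.b₄]; ring

/-- `Δ = -16(4a³ + 27b²)`. [folklore] -/
theorem Δ_short (a b : R) :
    (⟨0, 0, 0, a, b⟩ : WeierstrassCurve R).Δ = -16 * (4 * a ^ 3 + 27 * b ^ 2) := by
  simp only [WeierstrassCurve.Δ, WeierstrassCurve.b₂, WeierstrassCurve.b₄, WeierstrassCurve.b₆,
    WeierstrassCurve.b₈]; ring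

/-- The node-tangent polynomial of `[0, 0, 0, a, b]` is `-48a·T² + 0·T + (-216b)`. [folklore] -/
theorem nodalTangents_short (a b : R) :
    letI I : WeierstrassCurve R := ⟨0, 0, 0, a, b⟩
    C I.c₄ * X ^ 2 + C (I.a₁ * I.c₄) * X - C (54 * I.b₆ - 3 * I.b₂ * I.b₄ + I.a₂ * I.c₄) =
      C (-48 * a) * X ^ 2 + C 0 * X + C (-(216 * b)) := by
  simp only [WeierstrassCurve.c₄, WeierstrassCurve.b₂, WeierstrassCurve.b₄, WeierstrassCurve.b₆,
    map_zero, zero_mul, map_neg, sub_eq_add_neg]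
  congr 1
  · congr 2
    · congr 1; ring
  · congr 1; ring

/-- The discriminant of that quadratic is `-2⁹3⁴·ab = (144)²·(-2ab)`. [folklore] -/
theorem discrim_nodalTangents_short (a b : R) :
    discrim (-48 * a) 0 (-(216 * b)) = 144 ^ 2 * (-2 * a * b) := by
  simp only [discrim]; ring

/-! ### `E_{A,B}` over `ℚ_p` -/

variable (p : ℕ) [hp : Fact p.Prime]

/-- `E_{A,B} ⊗ ℚ_p` is the base change of the `ℤ_p`-integral equation `[0, 0, 0, A, B]`. [folklore] -/
theorem baseChange_shortWeierstrass_padic (AB : ℤ × ℤ) :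
    (shortWeierstrass AB).baseChange ℚ_[p] =
      (⟨0, 0, 0, (AB.1 : ℤ_[p]), (AB.2 : ℤ_[p])⟩ : WeierstrassCurve ℤ_[p]).baseChange ℚ_[p] := by
  ext <;> simp [shortWeierstrass, WeierstrassCurve.baseChange, WeierstrassCurve.map]

/-- `E_{A,B} ⊗ ℚ_p` is `ℤ_p`-integral (a theorem, used via `haveI`). [folklore] -/
theorem isIntegral_padic (AB : ℤ × ℤ) : ((shortWeierstrass AB).baseChange ℚ_[p]).IsIntegral ℤ_[p] :=
  ⟨⟨_, baseChange_shortWeierstrass_padic p AB⟩⟩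

/-- Mathlib's integral model of `E_{A,B} ⊗ ℚ_p` is `[0, 0, 0, A, B]` over `ℤ_p` (base change along
the injective `ℤ_p → ℚ_p` is injective on Weierstrass equations). [folklore] -/
theorem integralModel_padic (AB : ℤ × ℤ) :
    haveI := isIntegral_padic p AB
    ((shortWeierstrass AB).baseChange ℚ_[p]).integralModel ℤ_[p] =
      ⟨0, 0, 0, (AB.1 : ℤ_[p]), (AB.2 : ℤ_[p])⟩ := by
  haveI := isIntegral_padic p AB
  apply WeierstrassCurve.map_injective (f := algebraMap ℤ_[p] ℚ_[p]) (IsFractionRing.injective _ _)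
  change (((shortWeierstrass AB).baseChange ℚ_[p]).integralModel ℤ_[p]).baseChange ℚ_[p] =
    (⟨0, 0, 0, (AB.1 : ℤ_[p]), (AB.2 : ℤ_[p])⟩ : WeierstrassCurve ℤ_[p]).baseChange ℚ_[p]
  rw [baseChange_integralModel_eq, baseChange_shortWeierstrass_padic]

/-- An integer lies in `𝔪_{ℤ_p}` iff `p` divides it. [folklore] -/
theorem intCast_mem_maximalIdeal_iff (n : ℤ) : (n : ℤ_[p]) ∈ maximalIdeal ℤ_[p] ↔ (p : ℤ) ∣ n := by
  rw [IsLocalRing.mem_maximalIdeal, PadicInt.mem_nonunits, PadicInt.norm_int_lt_one_iff_dvd]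

variable {p}

/-- `c₄(E_{A,B}) = -48A` is a `p`-adic unit for `p ≥ 5`, `p ∤ A`. [folklore] -/
theorem valuation_c₄_eq_one {AB : ℤ × ℤ} (h5 : 5 ≤ p) (hA : ¬ (p : ℤ) ∣ AB.1) :
    (IsDiscreteValuationRing.maximalIdeal ℤ_[p]).valuation ℚ_[p]
      ((shortWeierstrass AB).baseChange ℚ_[p]).c₄ = 1 := by
  rw [baseChange_shortWeierstrass_padic, WeierstrassCurve.baseChange, map_c₄,
    HeightOneSpectrum.valuation_eq_one_iff_notMem, c₄_short]
  change -48 * (AB.1 : ℤ_[p]) ∉ IsLocalRing.maximalIdeal ℤ_[p]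
  rw [show (-48 * (AB.1 : ℤ_[p])) = ((-48 * AB.1 : ℤ) : ℤ_[p]) by push_cast; ring,
    intCast_mem_maximalIdeal_iff, BSZLemma17.dvd_c₄_iff hp.out h5]
  exact hA

/-- `Δ(E_{A,B}) ∈ 𝔪_{ℤ_p}` when `p ∣ 4A³ + 27B²`. [folklore] -/
theorem valuation_Δ_lt_one {AB : ℤ × ℤ} (hD : (p : ℤ) ∣ 4 * AB.1 ^ 3 + 27 * AB.2 ^ 2) :
    (IsDiscreteValuationRing.maximalIdeal ℤ_[p]).valuation ℚ_[p]
      ((shortWeierstrass AB).baseChange ℚ_[p]).Δ < 1 := by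
  rw [baseChange_shortWeierstrass_padic, WeierstrassCurve.baseChange, map_Δ,
    HeightOneSpectrum.valuation_lt_one_iff_mem, Δ_short]
  change -16 * (4 * (AB.1 : ℤ_[p]) ^ 3 + 27 * (AB.2 : ℤ_[p]) ^ 2) ∈ IsLocalRing.maximalIdeal ℤ_[p]
  rw [show -16 * (4 * (AB.1 : ℤ_[p]) ^ 3 + 27 * (AB.2 : ℤ_[p]) ^ 2) =
      ((-16 * (4 * AB.1 ^ 3 + 27 * AB.2 ^ 2) : ℤ) : ℤ_[p]) by push_cast; ring,
    intCast_mem_maximalIdeal_iff]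
  exact hD.mul_left _

/-- **`E_{A,B} ⊗ ℚ_p` is a minimal equation with multiplicative reduction** for `p ≥ 5`, `p ∤ A`,
`p ∣ 4A³ + 27B²` (unit `c₄`, Silverman VII.1 Rem. 1.1 and VII.5 Prop. 5.1(b); a theorem producing
the Mathlib class, used via `haveI`). [cite: SilvermanAEC2009, VII.5 Prop. 5.1(b)] -/
theorem hasMultiplicativeReduction_padic {AB : ℤ × ℤ} (h5 : 5 ≤ p) (hA : ¬ (p : ℤ) ∣ AB.1)
    (hD : (p : ℤ) ∣ 4 * AB.1 ^ 3 + 27 * AB.2 ^ 2) :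
    ((shortWeierstrass AB).baseChange ℚ_[p]).HasMultiplicativeReduction ℤ_[p] :=
  haveI := isIntegral_padic p AB
  haveI : ((shortWeierstrass AB).baseChange ℚ_[p]).IsMinimal ℤ_[p] :=
    isMinimal_of_valuation_c₄_eq_one _ (valuation_c₄_eq_one h5 hA)
  { badReduction := valuation_Δ_lt_one hD
    multiplicativeReduction := valuation_c₄_eq_one h5 hA }

/-! ### Squares in the residue field of `ℤ_p` -/

variable (p)

/-- Mathlib's isomorphism `ResidueField ℤ_p ≃ ℤ/p` sends the residue of an integer `n` to `n mod p`.
[folklore] -/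
theorem residueField_residue_intCast (n : ℤ) :
    PadicInt.residueField (IsLocalRing.residue ℤ_[p] (n : ℤ_[p])) = (n : ZMod p) := by
  rw [map_intCast, map_intCast]

/-- The residue of an integer `n` is a square in the residue field of `ℤ_p` iff `n` is a square
modulo `p`. [folklore] -/
theorem isSquare_residue_intCast_iff (n : ℤ) :
    IsSquare (IsLocalRing.residue ℤ_[p] (n : ℤ_[p])) ↔ IsSquare (n : ZMod p) := by
  constructor
  · rintro ⟨r, hr⟩
    refine ⟨PadicInt.residueField r, ?_⟩
    rw [← residueField_residue_intCast, hr, map_mul]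
  · rintro ⟨r, hr⟩
    refine ⟨PadicInt.residueField.symm r, ?_⟩
    apply PadicInt.residueField.injective
    rw [residueField_residue_intCast, hr, map_mul, RingEquiv.apply_symm_apply]

/-- The residue of an integer prime to `p` is nonzero. [folklore] -/
theorem residue_intCast_ne_zero {n : ℤ} (h : ¬ (p : ℤ) ∣ n) :
    IsLocalRing.residue ℤ_[p] (n : ℤ_[p]) ≠ 0 := by
  rw [ne_eq, IsLocalRing.residue_eq_zero_iff, intCast_mem_maximalIdeal_iff]
  exact h

variable {p}

/-- **Split multiplicative reduction of the equation `E_{A,B} ⊗ ℚ_p` read off modulo `p`**: for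
`p ≥ 5`, `p ∤ A`, `p ∣ 4A³ + 27B²`, the (minimal) equation `E_{A,B}` has split multiplicative
reduction over `ℤ_p` iff `-2AB` is a square mod `p` (node-tangent polynomial `-48A·T² - 216B` of
discriminant `144²·(-2AB)`). [cite: BhargavaSkinnerZhang2014, Lemma 18 (proof)] -/
theorem hasSplitMultiplicativeReduction_padic_iff {AB : ℤ × ℤ} (h5 : 5 ≤ p) (hA : ¬ (p : ℤ) ∣ AB.1)
    (hD : (p : ℤ) ∣ 4 * AB.1 ^ 3 + 27 * AB.2 ^ 2) :
    ((shortWeierstrass AB).baseChange ℚ_[p]).HasSplitMultiplicativeReduction ℤ_[p] ↔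
      IsSquare (-2 * (AB.1 : ZMod p) * (AB.2 : ZMod p)) := by
  haveI := isIntegral_padic p AB
  have hmult := hasMultiplicativeReduction_padic h5 hA hD
  have hp2 : ¬ (p : ℤ) ∣ 2 := fun h ↦ BSZLemma17.not_dvd_two hp.out h5 (by exact_mod_cast h)
  have hp48A : ¬ (p : ℤ) ∣ -48 * AB.1 := fun h ↦ hA ((BSZLemma17.dvd_c₄_iff hp.out h5 AB.1).mp h)
  have hp144 : ¬ (p : ℤ) ∣ 144 := by
    intro h
    have h' : (p : ℤ) ^ 1 ∣ (2 : ℤ) ^ 4 * 3 ^ 2 * 1 := by rw [pow_one]; norm_num; exact h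
    have h1 := BSZLemma17.pow_dvd_of_pow_dvd_mul hp.out h5 1 4 2 h'
    rw [pow_one] at h1
    have := Int.eq_one_of_dvd_one (by positivity) h1
    have h2 := hp.out.one_lt
    omega
  set k := ResidueField ℤ_[p] with hk
  set f := IsLocalRing.residue ℤ_[p] with hf
  haveI : NeZero (2 : k) := ⟨by
    have h := residue_intCast_ne_zero p hp2
    rwa [Int.cast_ofNat, map_ofNat] at h⟩
  -- the node-tangent polynomial of `[0, 0, 0, A, B]` over `k` and its splitting
  have hpoly : Polynomial.map (algebraMap ℤ_[p] k)
      (letI I : WeierstrassCurve ℤ_[p] := ⟨0, 0, 0, (AB.1 : ℤ_[p]), (AB.2 : ℤ_[p])⟩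
       C I.c₄ * X ^ 2 + C (I.a₁ * I.c₄) * X - C (54 * I.b₆ - 3 * I.b₂ * I.b₄ + I.a₂ * I.c₄)) =
      C (f (-48 * (AB.1 : ℤ_[p]))) * X ^ 2 + C (f 0) * X + C (f (-(216 * (AB.2 : ℤ_[p])))) := by
    rw [nodalTangents_short, IsLocalRing.ResidueField.algebraMap_eq]
    simp only [Polynomial.map_add, Polynomial.map_mul, Polynomial.map_pow, Polynomial.map_C,
      Polynomial.map_X, hf]
  have ha : f (-48 * (AB.1 : ℤ_[p])) ≠ 0 := by
    have h := residue_intCast_ne_zero p hp48A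
    push_cast at h
    exact h
  have h144 : (f 144) ≠ 0 := by
    have h := residue_intCast_ne_zero p hp144
    push_cast at h
    exact h
  have hdisc : discrim (f (-48 * (AB.1 : ℤ_[p]))) (f 0) (f (-(216 * (AB.2 : ℤ_[p])))) =
      f 144 ^ 2 * f (((-2 * AB.1 * AB.2 : ℤ) : ℤ_[p])) := by
    have e : discrim (f (-48 * (AB.1 : ℤ_[p]))) (f 0) (f (-(216 * (AB.2 : ℤ_[p])))) =
        f (discrim (-48 * (AB.1 : ℤ_[p])) 0 (-(216 * (AB.2 : ℤ_[p])))) := by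
      simp only [discrim, map_sub, map_mul, map_pow, map_zero, map_ofNat]
    rw [e, discrim_nodalTangents_short, map_mul, map_pow]
    push_cast
    rfl
  have hsplit : Splits (Polynomial.map (algebraMap ℤ_[p] k)
      (letI I : WeierstrassCurve ℤ_[p] := ⟨0, 0, 0, (AB.1 : ℤ_[p]), (AB.2 : ℤ_[p])⟩
       C I.c₄ * X ^ 2 + C (I.a₁ * I.c₄) * X - C (54 * I.b₆ - 3 * I.b₂ * I.b₄ + I.a₂ * I.c₄))) ↔
      IsSquare (-2 * (AB.1 : ZMod p) * (AB.2 : ZMod p)) := by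
    rw [hpoly, splits_quadratic_iff_isSquare_discrim ha, hdisc, isSquare_mul_sq_iff h144,
      isSquare_residue_intCast_iff]
    push_cast
    rfl
  constructor
  · intro hs
    have h1 := hs.splitMultiplicativeReduction
    rw [integralModel_padic] at h1
    exact hsplit.mp h1
  · intro hsq
    haveI := hmult
    refine ⟨?_⟩
    rw [integralModel_padic]
    exact hsplit.mpr hsq

/-! ### Prime-indexed form -/

/-- **Split multiplicative reduction of `E_{A,B}` at a prime `p ≥ 5` of multiplicative reduction
iff `-2AB` is a square mod `p`** (`p ∤ A`, `p ∣ 4A³ + 27B² ≠ 0`; the tree's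
`HasSplitMultiplicativeReductionAtPrime`, i.e. Mathlib's chosen `ℤ_p`-minimal model, reached from
the minimal equation `E_{A,B}` by `hasSplitMultiplicativeReduction_iff_of_isMinimal_of_eq_smul`).
The source's formulation "iff `u⁴ ≡ -3A (mod p)` has a solution" agrees with this for
`p ≡ 1 (mod 4)` (so at `p = 5`); see the module docstring. [cite: BhargavaSkinnerZhang2014, Lemma 18 (proof)] -/
theorem hasSplitMultiplicativeReductionAtPrime_shortWeierstrass_iff {AB : ℤ × ℤ} (p : ℕ)
    [hp : Fact p.Prime] (h5 : 5 ≤ p) (hA : ¬ (p : ℤ) ∣ AB.1)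
    (hD : (p : ℤ) ∣ 4 * AB.1 ^ 3 + 27 * AB.2 ^ 2) (hΔ : 4 * AB.1 ^ 3 + 27 * AB.2 ^ 2 ≠ 0) :
    (shortWeierstrass AB).HasSplitMultiplicativeReductionAtPrime p ↔
      IsSquare (-2 * (AB.1 : ZMod p) * (AB.2 : ZMod p)) := by
  haveI := BSZLemma17.isElliptic_of_ne_zero hΔ
  unfold HasSplitMultiplicativeReductionAtPrime
  set X : WeierstrassCurve ℚ_[p] := (shortWeierstrass AB).baseChange ℚ_[p] with hX
  haveI : X.IsIntegral ℤ_[p] := isIntegral_padic p AB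
  haveI : X.IsMinimal ℤ_[p] := isMinimal_of_valuation_c₄_eq_one _ (valuation_c₄_eq_one h5 hA)
  have hmin : X.minimal ℤ_[p] = (X.exists_isMinimal ℤ_[p]).choose • X := rfl
  have hΔ' : X.Δ ≠ 0 := by
    rw [hX, WeierstrassCurve.baseChange, map_Δ]
    exact (_root_.map_ne_zero _).mpr (shortWeierstrass AB).isUnit_Δ.ne_zero
  rw [hasSplitMultiplicativeReduction_iff_of_isMinimal_of_eq_smul ℤ_[p] hmin hΔ']
  exact hasSplitMultiplicativeReduction_padic_iff h5 hA hD

/-! ### The residue classes modulo `5` -/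

/-- **The residue computation modulo `5`** behind `Σ₅^spl` and `Σ₅^ns`: for `a ≢ 0 (mod 5)` with
`4a³ + 27b² ≡ 0`, either `(a, b) ≡ (3, ±1)` and `-2ab` is a square, or `(a, b) ≡ (2, ±2)` and it
is not (kernel decision over `ℤ/5`). [cite: BhargavaSkinnerZhang2014, Lemma 18 (proof)] -/
theorem bsz_sigma_classes_mod_five :
    ∀ a b : ZMod 5, a ≠ 0 → 4 * a ^ 3 + 27 * b ^ 2 = 0 →
      ((∃ r : ZMod 5, -2 * a * b = r * r) ↔ a = 3 ∧ (b = 1 ∨ b = 4)) ∧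
      ((¬ ∃ r : ZMod 5, -2 * a * b = r * r) ↔ a = 2 ∧ (b = 2 ∨ b = 3)) := by
  decide

/-- `3 ≢ 0` and `2 ≢ 0 (mod 5)`. [folklore] -/
theorem three_ne_zero_zmod_five : (3 : ZMod 5) ≠ 0 ∧ (2 : ZMod 5) ≠ 0 := by decide

/-- The classes `(3, ±1)` and `(2, ±2)` modulo `5` satisfy `4a³ + 27b² ≡ 0`. [folklore] -/
theorem disc_zero_of_classes_zmod_five :
    (∀ b : ZMod 5, b = 1 ∨ b = 4 → 4 * (3 : ZMod 5) ^ 3 + 27 * b ^ 2 = 0) ∧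
    (∀ b : ZMod 5, b = 2 ∨ b = 3 → 4 * (2 : ZMod 5) ^ 3 + 27 * b ^ 2 = 0) := by decide

/-- Multiplicative reduction of `E_{A,B}` at `5` forces `(A, B) ≡ (2, ±2)` or `(3, ±1) (mod 5)`.
[cite: BhargavaSkinnerZhang2014, Lemma 18 (proof)] -/
theorem residues_of_five_dvd {A B : ℤ} (hA : ¬ (5 : ℤ) ∣ A) (hD : (5 : ℤ) ∣ 4 * A ^ 3 + 27 * B ^ 2) :
    (A : ZMod 5) ≠ 0 ∧ 4 * (A : ZMod 5) ^ 3 + 27 * (B : ZMod 5) ^ 2 = 0 := by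
  refine ⟨fun h ↦ hA ?_, ?_⟩
  · exact_mod_cast (ZMod.intCast_zmod_eq_zero_iff_dvd A 5).mp h
  · have := (ZMod.intCast_zmod_eq_zero_iff_dvd (4 * A ^ 3 + 27 * B ^ 2) 5).mpr (by exact_mod_cast hD)
    push_cast at this
    exact this

end BSZLemma18Split

open BSZLemma18Split

/-- **`Σ₅^spl`: `E_{A,B}` has split multiplicative reduction at `5` iff `A ≡ 3` and
`B ≡ ±1 (mod 5)`**, for `4A³ + 27B² ≠ 0` and `¬(5⁴ ∣ A ∧ 5⁶ ∣ B)` (every member of the height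
family) — the residue description of the set `Σ₅^spl` in the proof of Lemma 18 of the source
(there intersected with the `5 ∤ ord₅Δ` and `𝓛`-conditions, which are not reduction-type
conditions). Residues are written as casts to `ZMod 5` (`B ≡ ±1 ↔ (B : ZMod 5) ∈ {1, 4}`).
[cite: BhargavaSkinnerZhang2014, Lemma 18 (proof)] -/
theorem hasSplitMultiplicativeReductionAtPrime_five_shortWeierstrass_iff {AB : ℤ × ℤ}
    [Fact (Nat.Prime 5)] (hΔ : 4 * AB.1 ^ 3 + 27 * AB.2 ^ 2 ≠ 0)
    (hfam : ¬ ((5 : ℤ) ^ 4 ∣ AB.1 ∧ (5 : ℤ) ^ 6 ∣ AB.2)) :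
    (shortWeierstrass AB).HasSplitMultiplicativeReductionAtPrime 5 ↔
      (AB.1 : ZMod 5) = 3 ∧ ((AB.2 : ZMod 5) = 1 ∨ (AB.2 : ZMod 5) = 4) := by
  have hmult := hasMultiplicativeReductionAtPrime_shortWeierstrass_iff 5 le_rfl hΔ
    (by exact_mod_cast hfam)
  constructor
  · intro hs
    obtain ⟨hD, hA⟩ := hmult.mp hs.hasMultiplicativeReductionAtPrime
    have hD' : (5 : ℤ) ∣ 4 * AB.1 ^ 3 + 27 * AB.2 ^ 2 := by exact_mod_cast hD
    have hA' : ¬ (5 : ℤ) ∣ AB.1 := by exact_mod_cast hA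
    obtain ⟨ha0, hab⟩ := residues_of_five_dvd hA' hD'
    have hsq := (hasSplitMultiplicativeReductionAtPrime_shortWeierstrass_iff 5 le_rfl hA hD hΔ).mp hs
    exact ((bsz_sigma_classes_mod_five _ _ ha0 hab).1).mp hsq
  · rintro ⟨ha, hb⟩
    have hA : ¬ (5 : ℤ) ∣ AB.1 := by
      intro h
      have := (ZMod.intCast_zmod_eq_zero_iff_dvd AB.1 5).mpr (by exact_mod_cast h)
      rw [ha] at this
      exact three_ne_zero_zmod_five.1 this
    have hD : (5 : ℤ) ∣ 4 * AB.1 ^ 3 + 27 * AB.2 ^ 2 := by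
      have h0 : ((4 * AB.1 ^ 3 + 27 * AB.2 ^ 2 : ℤ) : ZMod 5) = 0 := by
        push_cast
        rw [ha]
        exact disc_zero_of_classes_zmod_five.1 _ hb
      exact_mod_cast (ZMod.intCast_zmod_eq_zero_iff_dvd _ 5).mp h0
    refine (hasSplitMultiplicativeReductionAtPrime_shortWeierstrass_iff 5 le_rfl
      (by exact_mod_cast hA) (by exact_mod_cast hD) hΔ).mpr ?_
    obtain ⟨ha0, hab⟩ := residues_of_five_dvd hA hD
    exact ((bsz_sigma_classes_mod_five _ _ ha0 hab).1).mpr ⟨ha, hb⟩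

/-- **`Σ₅^ns`: `E_{A,B}` has non-split multiplicative reduction at `5` iff `A ≡ 2` and
`B ≡ ±2 (mod 5)`**, for `4A³ + 27B² ≠ 0` and `¬(5⁴ ∣ A ∧ 5⁶ ∣ B)` — the residue description of
`Σ₅^ns` in the proof of Lemma 18 of the source (there intersected with `5 ∤ ord₅Δ`).
[cite: BhargavaSkinnerZhang2014, Lemma 18 (proof)] -/
theorem hasMultiplicative_not_split_five_shortWeierstrass_iff {AB : ℤ × ℤ} [Fact (Nat.Prime 5)]
    (hΔ : 4 * AB.1 ^ 3 + 27 * AB.2 ^ 2 ≠ 0) (hfam : ¬ ((5 : ℤ) ^ 4 ∣ AB.1 ∧ (5 : ℤ) ^ 6 ∣ AB.2)) :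
    (shortWeierstrass AB).HasMultiplicativeReductionAtPrime 5 ∧
        ¬ (shortWeierstrass AB).HasSplitMultiplicativeReductionAtPrime 5 ↔
      (AB.1 : ZMod 5) = 2 ∧ ((AB.2 : ZMod 5) = 2 ∨ (AB.2 : ZMod 5) = 3) := by
  have hmult := hasMultiplicativeReductionAtPrime_shortWeierstrass_iff 5 le_rfl hΔ
    (by exact_mod_cast hfam)
  constructor
  · rintro ⟨hm, hns⟩
    obtain ⟨hD, hA⟩ := hmult.mp hm
    have hD' : (5 : ℤ) ∣ 4 * AB.1 ^ 3 + 27 * AB.2 ^ 2 := by exact_mod_cast hD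
    have hA' : ¬ (5 : ℤ) ∣ AB.1 := by exact_mod_cast hA
    obtain ⟨ha0, hab⟩ := residues_of_five_dvd hA' hD'
    have hsq : ¬ IsSquare (-2 * (AB.1 : ZMod 5) * (AB.2 : ZMod 5)) := fun h ↦
      hns ((hasSplitMultiplicativeReductionAtPrime_shortWeierstrass_iff 5 le_rfl hA hD hΔ).mpr h)
    exact ((bsz_sigma_classes_mod_five _ _ ha0 hab).2).mp hsq
  · rintro ⟨ha, hb⟩
    have hA : ¬ (5 : ℤ) ∣ AB.1 := by
      intro h
      have := (ZMod.intCast_zmod_eq_zero_iff_dvd AB.1 5).mpr (by exact_mod_cast h)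
      rw [ha] at this
      exact three_ne_zero_zmod_five.2 this
    have hD : (5 : ℤ) ∣ 4 * AB.1 ^ 3 + 27 * AB.2 ^ 2 := by
      have h0 : ((4 * AB.1 ^ 3 + 27 * AB.2 ^ 2 : ℤ) : ZMod 5) = 0 := by
        push_cast
        rw [ha]
        exact disc_zero_of_classes_zmod_five.2 _ hb
      exact_mod_cast (ZMod.intCast_zmod_eq_zero_iff_dvd _ 5).mp h0
    refine ⟨hmult.mpr ⟨by exact_mod_cast hD, by exact_mod_cast hA⟩, fun hs ↦ ?_⟩
    obtain ⟨ha0, hab⟩ := residues_of_five_dvd hA hD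
    have hsq := (hasSplitMultiplicativeReductionAtPrime_shortWeierstrass_iff 5 le_rfl
      (by exact_mod_cast hA) (by exact_mod_cast hD) hΔ).mp hs
    exact ((bsz_sigma_classes_mod_five _ _ ha0 hab).2).mpr ⟨ha, hb⟩ hsq

end Literature.NumberTheory.EllipticCurves
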